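import Mathlib
import Literature.RingTheory.DedekindDomain.BlockIdempotentFamily   -- ★ (O-CRT) `exists_blockIdempotentFamily`, `mul_self_sub_mem_span_pow`, `mul_mem_span_pow_of_mem_pow`
import HarnessLib

/-!
# The block idempotent at level `p^f` of an unramified prime under a ring involution

Topic `Literature/RingTheory/DedekindDomain`, namespace `Literature.RingTheory.DedekindDomain`.  THEOREMS ONLY (no `def`, no instance, no named fact);
Mathlib + ★ `BlockIdempotentFamily` (the CRT family `a_n ≡ 1 (w^{en})`, `a_n ≡ 0 (𝔟^n)` with its idempotency ∕ absorption rows, REUSED at `w := P̄`, `e := 1`, `n := f`).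

THE MATHEMATICS ([Neukirch1999] Ch. I §3 (3.6), the Chinese remainder theorem in a Dedekind domain; [Shimura1998] §13.1 Thm. 1 (pp. 97–99) for the use:
the `𝔭`∕`𝔭̄`-blocks of the `p^f`-torsion of a CM abelian variety).  Let `O` be a Dedekind domain with a ring involution `star` (e.g. complex conjugation on the
integers of a CM field), `P` a maximal ideal, `P̄ = star P`, and `p ∈ P` a rational integer UNRAMIFIED at `P` in the weak sense `¬ P² ∣ (p)`.  Then `(p) = P·𝔟` with
`P + 𝔟 = O` (§1), hence — applying `star` — `(p) = P̄·𝔟̄`, `P̄ + 𝔟̄ = O`, and for every `f ≥ 1` the Chinese remainder theorem on the comaximal pair `P̄^f`, `𝔟̄^f`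
produces `εu ∈ O` with `εu ≡ 1 (mod P̄^f)`, `εu ≡ 0 (mod 𝔟̄^f)` — the lift of the primitive idempotent of the `P̄`-factor of `O ∕ p^f = O ∕ P̄^f × O ∕ 𝔟̄^f`.  Consequently
`εu² − εu ∈ P̄^f 𝔟̄^f = (p^f)` (so `εu² = εu + p^f·c`), `P̄^f · εu ⊆ (p^f)`, and the conjugate `ē = star εu` is the `P`-block idempotent: `ē ≡ 1 (mod P^f)`, `ē ∈ 𝔟^f ⊆ 𝔟`
(§2 `exists_blockIdempotentAtLevel`, the seven rows in the token order of their consumer, plus `ē ∈ 𝔟^f`).  Cell `hodgecm-mathlib` (D-0151) organ (W-α) of the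
`w`-instantiation of the congruence relation (LA3-plan (g2) deal; consumer A-p03 (g32) `hlaw_w_sch₀Of`, binders `he hp𝔟 hw𝔟 hē1 hē0 hεu1 hεu0` VERBATIM at
`O := 𝓞 F`, `star :=` complex conjugation, `P := 𝔭_w`, `P̄ := 𝔭_{c•w}`); `--supports stmt-HodgeConjecture-24832`, count-neutral.
HC_CM is proved only modulo the 7 printed citations (2 remaining: hLiu418 = stmt-HodgeConjecture-24832, h413 = stmt-HodgeConjecture-24833) until rung 0 closes.

## Mathlib / tree search
Mathlib: `Ideal.dvd_span_singleton`, `Ideal.dvd_iff_le`, `Ideal.IsMaximal.eq_of_le`, `Ideal.pow_sup_pow_eq_top`, `Submodule.mem_sup`, `Ideal.map_mul`∕`map_pow`∕`map_sup`∕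
`map_span`∕`map_map`, `Ideal.mem_span_singleton'`; tree ★ `BlockIdempotentFamily` (imported: the element and its two rows), ★ `CRTIdempotentFamily` (the prime-indexed family;
here the second ideal `𝔟̄` is not prime), ★ `WeilDualityTwoBlockCut.exists_blockIdempotents` (level `p`, pointwise-`•` currency, both places unramified — a different row set),
★ `TorsionLayerBlockIdempotents` (group-scheme side, not imported).  New here: the unramified cofactor from `¬ P² ∣ (p)` and the `star`-transport to the `P`-block.

## References
* [Neukirch1999] J. Neukirch, *Algebraic Number Theory* (1999), Ch. I §3 (3.6).
* [Shimura1998] G. Shimura, *Abelian Varieties with Complex Multiplication and Modular Functions* (1998), §13.1 Thm. 1 (pp. 97–99).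
-/

set_option autoImplicit false

namespace Literature.RingTheory.DedekindDomain

variable {O : Type*} [CommRing O] [IsDedekindDomain O]

/-! ### §1 The unramified cofactor -/

/-- **`(x) = P · 𝔟` with `P + 𝔟 = O`** for a maximal `P ∋ x` with `¬ P² ∣ (x)` (the cofactor of an unramified prime is prime to it).
[cite: Neukirch1999, Ch. I §3 (3.6)] -/
theorem exists_span_singleton_eq_mul_and_sup_eq_top {P : Ideal O} (hP : P.IsMaximal) {x : O} (hx : x ∈ P)
    (hunr : ¬ P ^ 2 ∣ Ideal.span {x}) : ∃ 𝔟 : Ideal O, Ideal.span {x} = P * 𝔟 ∧ P ⊔ 𝔟 = ⊤ := by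
  obtain ⟨𝔟, h𝔟⟩ := Ideal.dvd_span_singleton.2 hx
  refine ⟨𝔟, h𝔟, ?_⟩
  by_contra hne
  have hle : 𝔟 ≤ P := (hP.eq_of_le hne le_sup_left).symm ▸ le_sup_right
  exact hunr (h𝔟 ▸ sq P ▸ mul_dvd_mul_left P (Ideal.dvd_iff_le.2 hle))

/-! ### §2 The block idempotent at level `p^f` -/

/-- **THE `P̄`-BLOCK IDEMPOTENT OF `O ∕ p^f` AND ITS CONJUGATE** — for a ring involution `star` of a Dedekind domain `O`, a maximal `P` with `star P = P̄`, a rational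
integer `p ∈ P` with `¬ P² ∣ (p)` and `f ≥ 1`: there are `εu c ∈ O` and an ideal `𝔟` with `εu² = εu + p^f·c`, `(p) = P·𝔟`, `P + 𝔟 = O`, `star εu − 1 ∈ P^f`, `star εu ∈ 𝔟`,
`εu − 1 ∈ P̄`, `P̄^f · εu ⊆ (p^f)`, and `star εu ∈ 𝔟^f` (`εu := a_f` of ★ `exists_blockIdempotentFamily` for the pair `P̄`, `𝔟̄ = star 𝔟`, `(p) = P̄·𝔟̄`; rows ★
`mul_self_sub_mem_span_pow` ∕ ★ `mul_mem_span_pow_of_mem_pow`; then apply `star`, `star ∘ star = id`).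
[cite: Neukirch1999, Ch. I §3 (3.6)] [cite: Shimura1998, §13.1 Thm. 1 (pp. 97–99)] -/
theorem exists_blockIdempotentAtLevel (star : O →+* O) (hstar : ∀ x, star (star x) = x)
    {P Pbar : Ideal O} (hP : P.IsMaximal) (hPbar : Ideal.map star P = Pbar)
    (p : ℕ) (hp : (p : O) ∈ P) (hunr : ¬ P ^ 2 ∣ Ideal.span {(p : O)}) {f : ℕ} (hf : 1 ≤ f) :
    ∃ (εu c : O) (𝔟 : Ideal O), εu * εu = εu + (p ^ f) • c ∧ Ideal.span {(p : O)} = P * 𝔟 ∧ P ⊔ 𝔟 = ⊤ ∧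
      star εu - 1 ∈ P ^ f ∧ star εu ∈ 𝔟 ∧ εu - 1 ∈ Pbar ∧ (∀ b ∈ Pbar ^ f, b * εu ∈ Ideal.span {((p ^ f : ℕ) : O)}) ∧
      star εu ∈ 𝔟 ^ f := by
  have hss : star.comp star = RingHom.id O := RingHom.ext hstar
  have hmm : ∀ I : Ideal O, Ideal.map star (Ideal.map star I) = I := fun I => by rw [Ideal.map_map, hss, Ideal.map_id]
  have hf0 : f ≠ 0 := Nat.one_le_iff_ne_zero.1 hf
  -- §1: `(p) = P 𝔟`, `P ⊔ 𝔟 = ⊤`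
  obtain ⟨𝔟, hp𝔟, hcop⟩ := exists_span_singleton_eq_mul_and_sup_eq_top hP hp hunr
  -- apply `star`: `(p) = P̄ 𝔟̄`, `P̄ ⊔ 𝔟̄ = ⊤`
  have hpbar : Ideal.span {(p : O)} = Pbar ^ 1 * Ideal.map star 𝔟 := by
    have h := congrArg (Ideal.map star) hp𝔟
    rwa [Ideal.map_mul, hPbar, Ideal.map_span, Set.image_singleton, map_natCast, ← pow_one Pbar] at h
  have hcopbar : Pbar ⊔ Ideal.map star 𝔟 = ⊤ := by
    have h := congrArg (Ideal.map star) hcop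
    rwa [Ideal.map_sup, Ideal.map_top, hPbar] at h
  -- ★ (O-CRT) the block idempotent family of the pair `P̄`, `𝔟̄` (`e = 1`) at level `f`, with its idempotency and absorption rows modulo `p^f`
  obtain ⟨a, ha1, ha0⟩ := exists_blockIdempotentFamily hcopbar 1
  have ha1f : a f - 1 ∈ Pbar ^ f := by simpa only [one_mul] using ha1 f
  obtain ⟨c, hc⟩ := Ideal.mem_span_singleton'.1 (mul_self_sub_mem_span_pow hpbar hcopbar ha1 ha0 f)
  refine ⟨a f, c, 𝔟, ?_, hp𝔟, hcop, ?_, ?_, Ideal.pow_le_self hf0 ha1f, fun b hb => ?_, ?_⟩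
  · rw [nsmul_eq_mul, Nat.cast_pow]
    linear_combination -hc
  · have h : star (a f - 1) ∈ Ideal.map star (Pbar ^ f) := Ideal.mem_map_of_mem star ha1f
    rwa [map_sub, map_one, Ideal.map_pow, ← hPbar, hmm] at h
  · have h : star (a f) ∈ Ideal.map star (Ideal.map star 𝔟 ^ f) := Ideal.mem_map_of_mem star (ha0 f)
    rw [Ideal.map_pow, hmm] at h
    exact Ideal.pow_le_self hf0 h
  · rw [Nat.cast_pow]
    exact mul_mem_span_pow_of_mem_pow hpbar hcopbar ha0 f ((one_mul f).symm ▸ hb)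
  · have h : star (a f) ∈ Ideal.map star (Ideal.map star 𝔟 ^ f) := Ideal.mem_map_of_mem star (ha0 f)
    rwa [Ideal.map_pow, hmm] at h

end Literature.RingTheory.DedekindDomain
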